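import Summits.QuantumFields.BalabanUV.Beta.StencilTableDataSorted

/-!
# Beta / StencilTableCovariance — THE REFLECTION-COVARIANCE BINDER `hRfl` OF A TYPED RATIONAL STENCIL TABLE DECIDED ON THE DATA
# (β sub-cell, BINDER-OWNERS row CAP-k, lineage `b2b-balaban-beta-an5`, gen 28; node BETA-an5-g28-EXPSUM, leaf 4 — sibling of `StencilTableData`)

WHY.  The one table-level binder of `CapWordListGL(Schedules).rowsGL_ofSchedulesQ_ofPairedBall` that `StencilTableData` leaves open is
`hRfl : ∀ ν p, (A (reflectAt ν p)).det = (A p).det`; the tree discharges it (`CapRouteABoxesReflect.det_reflectAt_of_relabel`) from cap5's LITERAL G6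
ENTRY FORM: per direction `ν` a relabelling `perm`, signs `s` (`s i · s i = 1`) and block shifts `dl` with
`K (shiftRefl ν (dl j − dl i) y) (perm i) (perm j) = s i · s j · K y i j` for ALL offsets `y` and index pairs — an identity over an INFINITE index set.
For a typed table it is a FINITE check: the key map `Φ (y, i, j) = (shiftRefl ν (dl j − dl i) y, perm i, perm j)` is injective.
* §1 `CovDatum N` = `(perm, pinv, s, dl)` over `Fin N` with DECIDABLE `Valid`; `toPerm`.
* §2 `QTable.covCheck T ν D : Bool` (per stored entry `entryQ (Φ k) = s i · s j · entryQ k`; quadratic: per-entry lookups), **`hK_of_covCheck`** (entry form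
  for ALL keys: Φ maps the finite non-zero key set into, hence onto, itself), **`det_reflectAt_family_of_covChecks`** = the binder `hRfl` BY NAME.
* §2b THE `n log n` VARIANT **`covCheckSorted`** (tables of the cell's size): tagged `entries`, `entryMap`, ONE comparison of `sortEntries (entries.map entryMap)`
  with `sortEntries entries` through a first-order encoding (in-kernel merge sort of `StencilTableDataSorted` on a natural-number key) ⟹ `entries.map entryMap
  ~ entries` ⟹ the entry form by permutation-invariance of the entry sums and injectivity of `Φ` alone; **`det_reflectAt_family_of_covChecksSorted`** and the
  per-direction **`det_reflectAt_family_of_covCheckSorted_dir`** (one kernel job per direction).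
* §3 the toy table of `StencilTableData` §6 (`perm = id`, `s ≡ 1`, `dl = (0, 2)`) passes both checks (`decide`); `hRfl` for `toyT.family` read back.
After leaves 3–4 EVERY table-level binder of the lane's typed target (`hA`, `hT'`, `hAn`, `hAc`, `rT`, `hRfl`, `hS`, tails, `hsmall`) is a kernel DECISION on
typed data plus the G6 data `(perm, s, dl)`; outside the kernel remain: per box leaf two finite norm sums, the (T) paired ball, the dictionary (N).

HONEST FRAMING.  Kernel glue ([folklore]: an injective self-map of a finite set is onto; merge sort permutes); no table of the cell typed here, no number
asserted; 0 binders of the real row instantiated; 0 certified coefficients; discharging `BetaPertH` would make Bałaban's UV stability UNCONDITIONAL — NOT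
the continuum limit, NOT Clay.  HONEST DEPENDENCY: continuum YM on T⁴ ⇐ BetaPertH ∧ nine spine estimates (0∕9 proved); BetaPertH ⇐ (D1) ∧ (D4) ∧ CAP+tail;
G-an2-4 gates asym, D1 and NE2∕3∕4.  0 `sorry`, 0 cite tags.
-/

namespace Summit.QuantumFields.BalabanUV.Beta.StencilTableData

open Complex Set Matrix Finset
open Summit.QuantumFields.BalabanUV.Beta.PolyRegularAlgebra (character)
open Summit.QuantumFields.BalabanUV.Beta.VertexToriSymmetry (reflectAt matCovariantQ_det_eq)
open Summit.QuantumFields.BalabanUV.Beta.TableCovariance (shiftRefl shiftRefl_shiftRefl relabelConjInv_mul matCovariantQ_characterSum_relabel)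
open Summit.QuantumFields.BalabanUV.Beta.CapRouteABoxesReflect (det_reflectAt_of_relabel)
open scoped Real ComplexConjugate Matrix.Norms.L2Operator

noncomputable section

/-! ## §1 The symmetry datum of one direction -/
/-- **THE G6 SYMMETRY DATUM of one lattice direction**: a relabelling `perm` of the internal indices with its inverse `pinv`, signs `s` and block
shifts `dl` (cap5's literal entry form; cap3-g15's `TableCovariance` socket). [folklore] -/
structure CovDatum (N : ℕ) where
  /-- the relabelling permutation (as a function). -/
  perm : Fin N → Fin N
  /-- its inverse (checked in `Valid`). -/
  pinv : Fin N → Fin N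
  /-- the signs `±1` (checked: `s i · s i = 1`). -/
  s : Fin N → ℚ
  /-- the block shifts. -/
  dl : Fin N → ℤ

namespace CovDatum

variable {N : ℕ} (D : CovDatum N)

/-- validity: `pinv` is a two-sided inverse of `perm` and the signs square to one. [folklore] -/
def Valid : Prop := (∀ i, D.pinv (D.perm i) = i) ∧ (∀ i, D.perm (D.pinv i) = i) ∧ ∀ i, D.s i * D.s i = 1

/-- validity is decidable (finitely many indices). [folklore] -/ instance decidableValid : Decidable D.Valid := by unfold Valid; infer_instance

/-- the permutation as an `Equiv.Perm`. [folklore] -/ def toPerm (h : D.Valid) : Equiv.Perm (Fin N) := ⟨D.perm, D.pinv, h.1, h.2.1⟩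

/-- its underlying function is `perm`. [folklore] -/ @[simp] theorem toPerm_apply (h : D.Valid) (i : Fin N) : D.toPerm h i = D.perm i := rfl
end CovDatum

/-! ## §2 The covariance check and the entry form for all offsets -/
namespace QTable

variable {d N : ℕ} (T : QTable d N)

/-- the stored keys `(y, i, j)` of the table (with repetitions). [folklore] -/ def storedKeys : List ((Fin (d + 1) → ℤ) × Fin N × Fin N) :=
  T.blocks.flatMap fun b => b.2.map fun e => (b.1, e.1, e.2.1)

/-- a key is stored iff some block at that offset holds an entry with that index pair. [folklore] -/
theorem mem_storedKeys {y : Fin (d + 1) → ℤ} {i j : Fin N} :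
    (y, i, j) ∈ T.storedKeys ↔ ∃ e ∈ T.blockAt y, e.1 = i ∧ e.2.1 = j := by
  constructor
  · intro h
    obtain ⟨⟨x, blk⟩, hb, h2⟩ := List.mem_flatMap.mp h
    obtain ⟨e, he, hk⟩ := List.mem_map.mp h2
    simp only [Prod.mk.injEq] at hk
    obtain ⟨rfl, rfl, rfl⟩ := hk
    exact ⟨e, T.mem_blockAt.mpr ⟨blk, hb, he⟩, rfl, rfl⟩
  · rintro ⟨e, he, rfl, rfl⟩
    obtain ⟨blk, hb, he'⟩ := T.mem_blockAt.mp he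
    exact List.mem_flatMap.mpr ⟨(y, blk), hb, List.mem_map.mpr ⟨e, he', rfl⟩⟩

/-- off the stored keys the entry vanishes. [folklore] -/
theorem entryQ_eq_zero_of_not_mem_storedKeys {y : Fin (d + 1) → ℤ} {i j : Fin N} (h : (y, i, j) ∉ T.storedKeys) :
    T.entryQ y i j = 0 :=
  T.entryQ_eq_zero_of_forall fun e he hh => h (T.mem_storedKeys.mpr ⟨e, he, hh⟩)

omit T in
/-- a COMPUTATIONAL form of `TableCovariance.shiftRefl` (non-dependent `if` instead of `Function.update`, so that the kernel evaluates it
cheaply inside the checks). [folklore] -/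
def shiftReflC (ν : Fin (d + 1)) (c : ℤ) (y : Fin (d + 1) → ℤ) : Fin (d + 1) → ℤ := fun μ => if μ = ν then c - y ν else y μ

omit T in
/-- it is the tree's `shiftRefl`. [folklore] -/
theorem shiftReflC_eq (ν : Fin (d + 1)) (c : ℤ) (y : Fin (d + 1) → ℤ) : shiftReflC ν c y = shiftRefl ν c y := by
  funext μ
  by_cases h : μ = ν
  · subst h; simp [shiftReflC]
  · simp [shiftReflC, h]

/-- the key map of direction `ν` under the datum `D` (computational form). [folklore] -/
def keyMap (ν : Fin (d + 1)) (D : CovDatum N) (k : (Fin (d + 1) → ℤ) × Fin N × Fin N) : (Fin (d + 1) → ℤ) × Fin N × Fin N :=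
  (shiftReflC ν (D.dl k.2.2 - D.dl k.2.1) k.1, D.perm k.2.1, D.perm k.2.2)

omit T in
/-- the key map in the tree's vocabulary. [folklore] -/
theorem keyMap_eq (ν : Fin (d + 1)) (D : CovDatum N) (y : Fin (d + 1) → ℤ) (i j : Fin N) :
    keyMap ν D (y, i, j) = (shiftRefl ν (D.dl j - D.dl i) y, D.perm i, D.perm j) := by
  simp only [keyMap, shiftReflC_eq]

omit T in
/-- the key map is injective for a valid datum. [folklore] -/
theorem keyMap_injective (ν : Fin (d + 1)) {D : CovDatum N} (hD : D.Valid) : Function.Injective (keyMap ν D) := by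
  rintro ⟨y, i, j⟩ ⟨y', i', j'⟩ h
  simp only [keyMap, shiftReflC_eq, Prod.mk.injEq] at h
  obtain ⟨hy, hi, hj⟩ := h
  have hi' : i = i' := by simpa [hD.1] using congrArg D.pinv hi
  have hj' : j = j' := by simpa [hD.1] using congrArg D.pinv hj
  subst hi' hj'
  have hy' := congrArg (shiftRefl ν (D.dl j - D.dl i)) hy
  rw [shiftRefl_shiftRefl, shiftRefl_shiftRefl] at hy'
  subst hy'
  rfl

/-- **THE COVARIANCE CHECK of direction `ν`**: for every stored entry `(y, i, j, _)`,
`entryQ (shiftRefl ν (dl j − dl i) y) (perm i) (perm j) = s i · s j · entryQ y i j`. [folklore] -/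
def covCheck (ν : Fin (d + 1)) (D : CovDatum N) : Bool :=
  T.blocks.all fun b => b.2.all fun e =>
    decide (T.entryQ (shiftReflC ν (D.dl e.2.1 - D.dl e.1) b.1) (D.perm e.1) (D.perm e.2.1) = D.s e.1 * D.s e.2.1 * T.entryQ b.1 e.1 e.2.1)

/-- what the check says at a stored key. [folklore] -/
theorem covCheck_spec {ν : Fin (d + 1)} {D : CovDatum N} (h : T.covCheck ν D = true) {y : Fin (d + 1) → ℤ} {i j : Fin N}
    (hk : (y, i, j) ∈ T.storedKeys) :
    T.entryQ (shiftRefl ν (D.dl j - D.dl i) y) (D.perm i) (D.perm j) = D.s i * D.s j * T.entryQ y i j := by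
  obtain ⟨e, he, rfl, rfl⟩ := T.mem_storedKeys.mp hk
  obtain ⟨blk, hb, heb⟩ := T.mem_blockAt.mp he
  unfold covCheck at h
  rw [List.all_eq_true] at h
  have h1 := h _ hb
  rw [List.all_eq_true] at h1
  rw [← shiftReflC_eq]
  exact of_decide_eq_true (h1 e heb)

/-- **THE ENTRY FORM FOR ALL OFFSETS AND INDICES FROM THE FINITE CHECK**: an injective key map sends the finite set of non-zero keys INTO itself
(the check), hence ONTO itself, hence zero keys to zero keys. [folklore] -/
theorem entryQ_keyMap_of_covCheck {ν : Fin (d + 1)} {D : CovDatum N} (hD : D.Valid) (h : T.covCheck ν D = true)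
    (y : Fin (d + 1) → ℤ) (i j : Fin N) :
    T.entryQ (shiftRefl ν (D.dl j - D.dl i) y) (D.perm i) (D.perm j) = D.s i * D.s j * T.entryQ y i j := by
  classical
  by_cases hk : (y, i, j) ∈ T.storedKeys
  · exact T.covCheck_spec h hk
  · have hz : T.entryQ y i j = 0 := T.entryQ_eq_zero_of_not_mem_storedKeys hk
    rw [hz, mul_zero]
    -- the finite set of keys with non-zero entry
    set NZ : Finset ((Fin (d + 1) → ℤ) × Fin N × Fin N) :=
      (T.storedKeys.filter fun k => decide (T.entryQ k.1 k.2.1 k.2.2 ≠ 0)).toFinset with hNZ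
    have memNZ : ∀ k, k ∈ NZ ↔ T.entryQ k.1 k.2.1 k.2.2 ≠ 0 := by
      intro k
      rw [hNZ, List.mem_toFinset, List.mem_filter, decide_eq_true_eq]
      constructor
      · exact fun hh => hh.2
      · intro hne
        refine ⟨?_, hne⟩
        by_contra hnot
        exact hne (T.entryQ_eq_zero_of_not_mem_storedKeys (y := k.1) (i := k.2.1) (j := k.2.2) hnot)
    -- the key map sends NZ into NZ
    have hinto : ∀ k ∈ NZ, keyMap ν D k ∈ NZ := by
      intro k hkNZ
      have hne := (memNZ k).mp hkNZ
      have hst : (k.1, k.2.1, k.2.2) ∈ T.storedKeys := by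
        by_contra hnot; exact hne (T.entryQ_eq_zero_of_not_mem_storedKeys hnot)
      have heq := T.covCheck_spec h hst
      refine (memNZ _).mpr ?_
      simp only [keyMap, shiftReflC_eq]
      rw [heq]
      have hs1 : D.s k.2.1 * D.s k.2.1 = 1 := hD.2.2 _
      have hs2 : D.s k.2.2 * D.s k.2.2 = 1 := hD.2.2 _
      intro h0
      rcases mul_eq_zero.mp h0 with h01 | h02
      · rcases mul_eq_zero.mp h01 with ha | hb
        · rw [ha, mul_zero] at hs1; exact zero_ne_one hs1
        · rw [hb, mul_zero] at hs2; exact zero_ne_one hs2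
      · exact hne h02
    -- hence onto NZ
    have himage : NZ.image (keyMap ν D) = NZ := by
      refine Finset.eq_of_subset_of_card_le (fun k hk' => ?_) ?_
      · obtain ⟨k₀, hk₀, rfl⟩ := Finset.mem_image.mp hk'
        exact hinto k₀ hk₀
      · rw [Finset.card_image_of_injective _ (keyMap_injective ν hD)]
    -- the key of the goal is not in NZ
    by_contra hne
    have hmem : keyMap ν D (y, i, j) ∈ NZ := (memNZ _).mpr (by simpa [keyMap, shiftReflC_eq] using hne)
    rw [← himage] at hmem
    obtain ⟨k₀, hk₀, heq⟩ := Finset.mem_image.mp hmem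
    have := keyMap_injective ν hD heq
    subst this
    exact (memNZ _).mp hk₀ hz

/-- the entry form read on the complex table `K`. [folklore] -/
theorem hK_of_covCheck {ν : Fin (d + 1)} {D : CovDatum N} (hD : D.Valid) (h : T.covCheck ν D = true) :
    ∀ y i j, T.K (shiftRefl ν (D.dl j - D.dl i) y) (D.toPerm hD i) (D.toPerm hD j)
      = ((D.s i : ℚ) : ℂ) * ((D.s j : ℚ) : ℂ) * T.K y i j := by
  intro y i j
  simp only [K_apply, CovDatum.toPerm_apply, T.entryQ_keyMap_of_covCheck hD h y i j]
  push_cast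
  ring

/-- **THE BINDER `hRfl` OF A TYPED LETTER FROM THE CHECKS**: one valid symmetry datum per direction whose covariance check passes ⟹
`det (T.family (reflectAt ν p)) = det (T.family p)` for every direction `ν` and every `p`. [folklore] -/
theorem det_reflectAt_family_of_covChecks (D : Fin (d + 1) → CovDatum N) (hD : ∀ ν, (D ν).Valid)
    (h : ∀ ν, T.covCheck ν (D ν) = true) :
    ∀ ν p, (T.family (reflectAt ν p)).det = (T.family p).det :=
  det_reflectAt_of_relabel T.support T.K (fun _ hx => T.K_eq_zero_of_not_mem hx) (fun ν => (D ν).toPerm (hD ν))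
    (fun ν i => (((D ν).s i : ℚ) : ℂ)) (fun ν => (D ν).dl)
    (fun ν i => by
      have h1 : (D ν).s i * (D ν).s i = 1 := (hD ν).2.2 i
      exact_mod_cast congrArg (fun r : ℚ => (r : ℂ)) h1)
    fun ν y i j => T.hK_of_covCheck (hD ν) (h ν) y i j

/-! ## §2b The linear-cost covariance check: sort-and-compare of the whole tagged entry list -/
omit T in
/-- the summed entry is additive over concatenation of blocks. [folklore] -/
theorem valAt_append (l₁ l₂ : List (Fin N × Fin N × ℚ)) (i j : Fin N) : valAt (l₁ ++ l₂) i j = valAt l₁ i j + valAt l₂ i j := by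
  unfold valAt
  rw [List.filter_append, List.map_append, List.sum_append]

/-- the tagged entry list `((x, i, j), v)` of the table. [folklore] -/ def entries : List (((Fin (d + 1) → ℤ) × Fin N × Fin N) × ℚ) :=
  T.blocks.flatMap fun b => b.2.map fun e => ((b.1, e.1, e.2.1), e.2.2)

omit T in
/-- block-list form of the summed entry versus the tagged entry list. [folklore] -/
theorem valAt_flatMap_eq_entries_sum (y : Fin (d + 1) → ℤ) (i j : Fin N) :
    ∀ Bs : List ((Fin (d + 1) → ℤ) × List (Fin N × Fin N × ℚ)),
      valAt ((Bs.filter fun b => decide (b.1 = y)).flatMap Prod.snd) i j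
        = (((Bs.flatMap fun b => b.2.map fun e => ((b.1, e.1, e.2.1), e.2.2)).filter fun e => decide (e.1 = (y, i, j))).map Prod.snd).sum
  | [] => by simp [valAt]
  | b :: Bs => by
    have ih := valAt_flatMap_eq_entries_sum y i j Bs
    rw [List.flatMap_cons, List.filter_append, List.map_append, List.sum_append, ← ih, List.filter_cons]
    have hb : ((b.2.map fun e => ((b.1, e.1, e.2.1), e.2.2)).filter fun e => decide (e.1 = (y, i, j))).map Prod.snd
        = if b.1 = y then ((b.2.filter fun e => decide (e.1 = i ∧ e.2.1 = j)).map fun e => e.2.2) else [] := by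
      rw [List.filter_map, List.map_map]
      by_cases hy : b.1 = y
      · rw [if_pos hy]
        have hp : ((fun e : ((Fin (d + 1) → ℤ) × Fin N × Fin N) × ℚ => decide (e.1 = (y, i, j))) ∘
            (fun e : Fin N × Fin N × ℚ => ((b.1, e.1, e.2.1), e.2.2))) = fun e => decide (e.1 = i ∧ e.2.1 = j) := by
          funext e; simp [Function.comp, hy, Prod.mk.injEq]
        rw [hp]; rfl
      · rw [if_neg hy]
        have hp : ((fun e : ((Fin (d + 1) → ℤ) × Fin N × Fin N) × ℚ => decide (e.1 = (y, i, j))) ∘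
            (fun e : Fin N × Fin N × ℚ => ((b.1, e.1, e.2.1), e.2.2))) = fun _ => false := by
          funext e; simp [Function.comp, Prod.mk.injEq, hy]
        rw [hp, List.filter_false, List.map_nil]
    rw [hb]
    by_cases hy : b.1 = y
    · rw [if_pos (by simpa using hy), if_pos hy, List.flatMap_cons, valAt_append]
      unfold valAt; rfl
    · rw [if_neg (by simpa using hy), if_neg hy, List.sum_nil, zero_add]

/-- the summed entry as a sum over the tagged entry list. [folklore] -/
theorem entryQ_eq_entries (y : Fin (d + 1) → ℤ) (i j : Fin N) :
    T.entryQ y i j = ((T.entries.filter fun e => decide (e.1 = (y, i, j))).map Prod.snd).sum := by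
  rw [entryQ_eq_valAt]
  exact valAt_flatMap_eq_entries_sum y i j T.blocks

/-- the key-and-sign map on tagged entries. [folklore] -/ def entryMap (ν : Fin (d + 1)) (D : CovDatum N) (e : ((Fin (d + 1) → ℤ) × Fin N × Fin N) × ℚ) :
    ((Fin (d + 1) → ℤ) × Fin N × Fin N) × ℚ :=
  (keyMap ν D e.1, D.s e.1.2.1 * D.s e.1.2.2 * e.2)

/-- a natural-number sort key of a tagged key: offsets (shifted by `2048`, base `4096`) then `i·N + j` — cheap for the kernel to recompute at every
comparison; injective on every table whose offsets lie in `[−2048, 2047]` (only the check's SUCCESS, never its soundness, depends on that). [folklore] -/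
def keyNum (k : (Fin (d + 1) → ℤ) × Fin N × Fin N) : ℕ :=
  (List.ofFn k.1).foldl (fun acc z => acc * 4096 + (z + 2048).toNat) 0 * (N * N) + (k.2.1.val * N + k.2.2.val)

/-- the canonical sort of a tagged entry list (merge sort on the precomputed `keyNum`). [folklore] -/
def sortEntries (l : List (((Fin (d + 1) → ℤ) × Fin N × Fin N) × ℚ)) : List (((Fin (d + 1) → ℤ) × Fin N × Fin N) × ℚ) :=
  (msortF (fun a b => decide (a.1 ≤ b.1)) l.length (l.map fun e => (keyNum e.1, e))).map Prod.snd

omit T in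
/-- the canonical sort is a permutation (keys precomputed once per entry, discarded after sorting). [folklore] -/
theorem sortEntries_perm (l : List (((Fin (d + 1) → ℤ) × Fin N × Fin N) × ℚ)) : (sortEntries l).Perm l := by
  unfold sortEntries
  have h := (msortF_perm (fun a b => decide (a.1 ≤ b.1)) l.length (l.map fun e => (keyNum e.1, e))).map Prod.snd
  rw [List.map_map] at h
  have e : (Prod.snd ∘ fun e : ((Fin (d + 1) → ℤ) × Fin N × Fin N) × ℚ => (keyNum e.1, e)) = id := rfl
  rw [e, List.map_id] at h
  exact h
omit T in
/-- a FIRST-ORDER encoding of a tagged entry (offsets as an integer list, indices as naturals): the kernel decides equality of encoded lists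
instantly, whereas deciding equality of the function-valued keys themselves can stall. [folklore] -/
def encEntry (e : ((Fin (d + 1) → ℤ) × Fin N × Fin N) × ℚ) : (List ℤ × ℕ × ℕ) × ℚ := ((List.ofFn e.1.1, e.1.2.1.val, e.1.2.2.val), e.2)

omit T in
/-- the encoding is injective. [folklore] -/
theorem encEntry_injective : Function.Injective (encEntry (d := d) (N := N)) := by
  rintro ⟨⟨x, i, j⟩, v⟩ ⟨⟨x', i', j'⟩, v'⟩ h
  simp only [encEntry, Prod.mk.injEq] at h
  obtain ⟨⟨hx, hi, hj⟩, hv⟩ := h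
  rw [List.ofFn_injective hx, Fin.ext hi, Fin.ext hj, hv]

/-- **THE SORTED COVARIANCE CHECK of direction `ν`**: the tagged entries mapped by `entryMap` sort to the same list as the entries (compared through
the first-order encoding `encEntry`). Cost `n log n`. [folklore] -/
def covCheckSorted (ν : Fin (d + 1)) (D : CovDatum N) : Bool :=
  decide ((sortEntries (T.entries.map (entryMap ν D))).map encEntry = (sortEntries T.entries).map encEntry)

/-- the check says: `entries.map entryMap ~ entries`. [folklore] -/
theorem entries_map_perm_of_covCheckSorted {ν : Fin (d + 1)} {D : CovDatum N} (h : T.covCheckSorted ν D = true) :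
    (T.entries.map (entryMap ν D)).Perm T.entries := by
  have h' : sortEntries (T.entries.map (entryMap ν D)) = sortEntries T.entries :=
    (List.map_injective_iff.mpr encEntry_injective) (of_decide_eq_true h)
  exact (sortEntries_perm _).symm.trans (h' ▸ sortEntries_perm _)

/-- **THE ENTRY FORM FOR ALL OFFSETS FROM THE SORTED CHECK** (permutation invariance of the entry sums + injectivity of the key map; no
finiteness argument needed). [folklore] -/
theorem entryQ_keyMap_of_covCheckSorted {ν : Fin (d + 1)} {D : CovDatum N} (hD : D.Valid) (h : T.covCheckSorted ν D = true)
    (y : Fin (d + 1) → ℤ) (i j : Fin N) :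
    T.entryQ (shiftRefl ν (D.dl j - D.dl i) y) (D.perm i) (D.perm j) = D.s i * D.s j * T.entryQ y i j := by
  have hp := T.entries_map_perm_of_covCheckSorted h
  have hinj := keyMap_injective (N := N) ν hD
  rw [entryQ_eq_entries, entryQ_eq_entries]
  have e1 : (shiftRefl ν (D.dl j - D.dl i) y, D.perm i, D.perm j) = keyMap ν D (y, i, j) := (keyMap_eq ν D y i j).symm
  rw [e1, ← ((hp.filter fun e => decide (e.1 = keyMap ν D (y, i, j))).map Prod.snd).sum_eq, List.filter_map, List.map_map]
  have hpred : ((fun e : ((Fin (d + 1) → ℤ) × Fin N × Fin N) × ℚ => decide (e.1 = keyMap ν D (y, i, j))) ∘ entryMap ν D)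
      = fun e => decide (e.1 = (y, i, j)) := by
    funext e
    simp only [Function.comp, entryMap]
    by_cases he : e.1 = (y, i, j)
    · simp [he]
    · have hne : keyMap ν D e.1 ≠ keyMap ν D (y, i, j) := fun hh => he (hinj hh)
      simp [he, hne]
  rw [hpred]
  have hmap : ∀ e ∈ T.entries.filter (fun e => decide (e.1 = (y, i, j))),
      (Prod.snd ∘ entryMap ν D) e = D.s i * D.s j * e.2 := by
    intro e he
    have hk : e.1 = (y, i, j) := by simpa using (List.mem_filter.mp he).2
    simp only [Function.comp, entryMap, hk]
  rw [List.map_congr_left hmap, List.sum_map_mul_left]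

/-- the entry form read on the complex table `K`, sorted check. [folklore] -/
theorem hK_of_covCheckSorted {ν : Fin (d + 1)} {D : CovDatum N} (hD : D.Valid) (h : T.covCheckSorted ν D = true) :
    ∀ y i j, T.K (shiftRefl ν (D.dl j - D.dl i) y) (D.toPerm hD i) (D.toPerm hD j)
      = ((D.s i : ℚ) : ℂ) * ((D.s j : ℚ) : ℂ) * T.K y i j := by
  intro y i j
  simp only [K_apply, CovDatum.toPerm_apply, T.entryQ_keyMap_of_covCheckSorted hD h y i j]
  push_cast
  ring

/-- **THE BINDER `hRfl` OF A TYPED LETTER FROM THE SORTED CHECKS** (linear cost; the cell's `k₀` size). [folklore] -/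
theorem det_reflectAt_family_of_covChecksSorted (D : Fin (d + 1) → CovDatum N) (hD : ∀ ν, (D ν).Valid)
    (h : ∀ ν, T.covCheckSorted ν (D ν) = true) :
    ∀ ν p, (T.family (reflectAt ν p)).det = (T.family p).det :=
  det_reflectAt_of_relabel T.support T.K (fun _ hx => T.K_eq_zero_of_not_mem hx) (fun ν => (D ν).toPerm (hD ν))
    (fun ν i => (((D ν).s i : ℚ) : ℂ)) (fun ν => (D ν).dl)
    (fun ν i => by
      have h1 : (D ν).s i * (D ν).s i = 1 := (hD ν).2.2 i
      exact_mod_cast congrArg (fun r : ℚ => (r : ℂ)) h1)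
    fun ν y i j => T.hK_of_covCheckSorted (hD ν) (h ν) y i j

/-- **ONE DIRECTION AT A TIME** (so that each direction's sorted check can run in its own kernel job): a valid datum whose sorted covariance check
passes in direction `ν` ⟹ `det (T.family (reflectAt ν p)) = det (T.family p)` for that `ν`. [folklore] -/
theorem det_reflectAt_family_of_covCheckSorted_dir (ν : Fin (d + 1)) (D : CovDatum N) (hD : D.Valid) (h : T.covCheckSorted ν D = true)
    (p : Fin (d + 1) → ℂ) : (T.family (reflectAt ν p)).det = (T.family p).det :=
  matCovariantQ_det_eq (A := T.family) (fun q => relabelConjInv_mul ν (D.toPerm hD) (fun i => ((D.s i : ℚ) : ℂ)) D.dl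
      (fun i => by
        have h1 : D.s i * D.s i = 1 := hD.2.2 i
        exact_mod_cast congrArg (fun r : ℚ => (r : ℂ)) h1) q)
    (matCovariantQ_characterSum_relabel ν (D.toPerm hD) (fun i => ((D.s i : ℚ) : ℂ)) D.dl T.support T.K
      (fun _ hx => T.K_eq_zero_of_not_mem hx) fun y i j => T.hK_of_covCheckSorted hD h y i j) p

end QTable

/-! ## §3 The toy table: `hRfl` decided -/
section Toy

/-- the symmetry datum of the toy table of `StencilTableData` §6: identity relabelling, unit signs, block shifts `dl = (0, 2)` (index `1` sits at
lattice position `1`, so `K[−y + dl_j − dl_i]_{ij} = K[y]_{ij}`). [folklore] -/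
def toyD : CovDatum 2 := ⟨id, id, fun _ => 1, fun i => if i = 0 then 0 else 2⟩

/-- KERNEL: the toy datum is valid. [folklore] -/ theorem toyD_valid : toyD.Valid := by decide +kernel

/-- KERNEL: the covariance check of the toy table passes in its one direction. [folklore] -/ theorem toyT_covCheck : toyT.covCheck 0 toyD = true := by decide +kernel

/-- KERNEL: the sorted covariance check of the toy table passes as well. [folklore] -/ theorem toyT_covCheckSorted : toyT.covCheckSorted 0 toyD = true := by decide +kernel

/-- read-back: **`hRfl` for the toy letter** — its determinant is invariant under the reflection `q₀ ↦ −q₀`. [folklore] -/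
theorem det_reflectAt_toy : ∀ ν p, (toyT.family (reflectAt ν p)).det = (toyT.family p).det :=
  toyT.det_reflectAt_family_of_covChecks (fun _ => toyD) (fun _ => toyD_valid) fun ν => by
    fin_cases ν; exact toyT_covCheck
end Toy

end

end Summit.QuantumFields.BalabanUV.Beta.StencilTableData
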